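import Literature.Barriers.CriticalPhenomena.RigorousRGSmallParameterReblocking
import Literature.Barriers.CriticalPhenomena.RigorousRGSmallParameterKChangeOfVariablesFactorisation
import HarnessLib

/-!
# `RigorousRGSmallParameter` (Slade, Theorem 1.4.1): `K^{(3)}` factorises over components at
# scale `j+1` ([BS-rg-step] Proposition (prop:K3): "`K^{(3)} ∈ 𝒦_{j+1}`")

Companion ("proof architecture") file of
`Literature/Barriers/CriticalPhenomena/RigorousRGSmallParameter.lean`, continuing
`RigorousRGSmallParameterReblocking.lean` (Map 3 of the renormalisation group step behind Slade's
Theorem 6.3.1 / the named fact `Slade2017_prop822`). [BS-rg-step] §5.1: "This is the only place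
where the factorisation property (Efaczz) of `𝔼₊` is used: it ensures that `K^{(3)}` obeys the
component factorisation property demanded by the space `𝒦_{j+1}` … Component factorisation is an
immediate consequence of the factorisation properties for `K^{(2)}` and the finite-range property
(Efaczz) of `𝔼₊`". With `K^{(3)}(U) = Σ_{X ∈ 𝒫̄_j(U)} Ĩ_pt^{U∖X} 𝔼₊(δI ∘ θK^{(2)})(X)` (`kthree`),
this file PROVES, in the abstract setting of the companion file (ring maps `θ, ι : 𝒩 → 𝒩̃`,
`E : 𝒩̃ → 𝒩`) and with the factorisation of `E` on separated products as a hypothesis (`hEfac`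
over `SepCond`: the two factors depend on the fluctuation field only inside the scale-`j`
small-set neighbourhoods of two non-touching `(j+1)`-polymers — discharged for the Gaussian `𝔼₊`
by `RigorousRGSmallParameterGaussianFactorisation.lean` plus the finite range of `C_{j+1}`):

* `sum_subpolymers_union`, **`circ_union_eq_mul`** (`(F ∘ G)(X₁ ∪ X₂) = (F ∘ G)(X₁)(F ∘ G)(X₂)`
  for a disjoint union when `F, G` are multiplicative across it), `components_union_of_not_touch`,
  **`mul_of_factorises`** (component factorisation ⇒ multiplicative over non-touching unions);
* `inter_mem_closureFiber`, `bclosure_union`, `sum_closureFiber_union`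
  (`𝒫̄_j(U₁ ∪ U₂) ≅ 𝒫̄_j(U₁) × 𝒫̄_j(U₂)`), `closureFiber_empty`, `kthree_empty`;
* `SupHyp` (abstract "`n ∈ 𝒩̃` depends on `ζ` only in `D`" predicate with the closure properties
  used), `SupHyp.circ_deltaI` (`(δI ∘ θK)(X) ∈ 𝒩̃(X^□)`, "the field locality is straightforward"),
  `SepCond`;
* **`kthree_union`** (`K^{(3)}(U₁ ∪ U₂) = K^{(3)}(U₁)K^{(3)}(U₂)` for non-touching `(j+1)`-polymers),
  `kthree_biUnion_of_isGas`, **`kthree_eq_prod_components`** (`K^{(3)}(U) = ∏_{Comp_{j+1}(U)} K^{(3)}`).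

Sources: D. C. Brydges, G. Slade, J. Stat. Phys. 159 (2015) 589–667, arXiv:1403.7256, §5.1
(Proposition (prop:K3) and the paragraph "To see that `K^{(3)}` is in `𝒦_{j+1}` …"), §1.3 (Efaczz);
G. Slade, arXiv:1611.06169, Definition 6.1.2.

## References

* [BrydgesSlade2015RGV] D. C. Brydges, G. Slade, *A renormalisation group method. V. A single
  renormalisation group step*, J. Stat. Phys. **159** (2015) 589–667, arXiv:1403.7256.
* [Slade2017] G. Slade, *Critical exponents for long-range O(n) models below the upper critical
  dimension*, Commun. Math. Phys. **358** (2018) 343–436, arXiv:1611.06169.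
-/

noncomputable section

open Finset

namespace Literature.Barriers.CriticalPhenomena

namespace LongRangePhi4

namespace Polymer

open Literature.Probability.LatticeModels

variable {d M : ℕ} [NeZero M]


/-! ## Sub-polymers and circle products of disjoint unions; `K^{(3)}` factorises -/

section UnionSplit

variable {R : Type*} [CommRing R] {b : ℕ}

/-- Sub-polymers of a disjoint union of polymers `X₁ ⊔ X₂` correspond to pairs of sub-polymers,
via `Y ↦ (Y ∩ X₁, Y ∩ X₂)`: re-indexing a sum. [folklore] -/
theorem sum_subpolymers_union {β : Type*} [AddCommMonoid β] {X₁ X₂ : Finset (TorusSite d M)}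
    (hX₁ : IsPolymer b X₁) (hX₂ : IsPolymer b X₂) (hd : Disjoint X₁ X₂) (f : Finset (TorusSite d M) → β) :
    ∑ Y ∈ subpolymers b (X₁ ∪ X₂), f Y = ∑ p ∈ subpolymers b X₁ ×ˢ subpolymers b X₂, f (p.1 ∪ p.2) := by
  classical
  have key : ∀ Y ∈ subpolymers b (X₁ ∪ X₂), Y ∩ X₁ ∪ Y ∩ X₂ = Y := fun Y hY => by
    rw [← inter_union_distrib_left, inter_eq_left.2 (mem_subpolymers.1 hY).1]
  refine Finset.sum_nbij' (fun Y => (Y ∩ X₁, Y ∩ X₂)) (fun p => p.1 ∪ p.2) ?_ ?_ ?_ ?_ ?_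
  · intro Y hY
    rw [mem_subpolymers] at hY
    simp only [mem_product, mem_subpolymers]
    exact ⟨⟨inter_subset_right, hY.2.inter hX₁⟩, ⟨inter_subset_right, hY.2.inter hX₂⟩⟩
  · rintro ⟨Y₁, Y₂⟩ hp
    simp only [mem_product, mem_subpolymers] at hp
    exact mem_subpolymers.2 ⟨union_subset_union hp.1.1 hp.2.1, hp.1.2.union hp.2.2⟩
  · intro Y hY
    exact key Y hY
  · rintro ⟨Y₁, Y₂⟩ hp
    simp only [mem_product, mem_subpolymers] at hp
    simp only [Prod.mk.injEq]
    constructor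
    · rw [union_inter_distrib_right, inter_eq_left.2 hp.1.1, disjoint_iff_inter_eq_empty.1 (hd.symm.mono_left hp.2.1),
        union_empty]
    · rw [union_inter_distrib_right, inter_eq_left.2 hp.2.1, disjoint_iff_inter_eq_empty.1 (hd.mono_left hp.1.1),
        empty_union]
  · intro Y hY
    show f Y = f (Y ∩ X₁ ∪ Y ∩ X₂)
    rw [key Y hY]

/-- **Circle product of a disjoint union**: if `F` and `G` are multiplicative over the splitting
`(A ⊆ X₁, B ⊆ X₂) ↦ A ∪ B` of polymers, then `(F ∘ G)(X₁ ∪ X₂) = (F ∘ G)(X₁) (F ∘ G)(X₂)`. [folklore] -/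
theorem circ_union_eq_mul {F G : Finset (TorusSite d M) → R} {X₁ X₂ : Finset (TorusSite d M)}
    (hX₁ : IsPolymer b X₁) (hX₂ : IsPolymer b X₂) (hd : Disjoint X₁ X₂)
    (hF : ∀ A B, IsPolymer b A → IsPolymer b B → A ⊆ X₁ → B ⊆ X₂ → F (A ∪ B) = F A * F B)
    (hG : ∀ A B, IsPolymer b A → IsPolymer b B → A ⊆ X₁ → B ⊆ X₂ → G (A ∪ B) = G A * G B) :
    circ b F G (X₁ ∪ X₂) = circ b F G X₁ * circ b F G X₂ := by
  classical
  unfold circ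
  rw [sum_subpolymers_union hX₁ hX₂ hd, Finset.sum_mul_sum, ← Finset.sum_product']
  refine Finset.sum_congr rfl ?_
  rintro ⟨Y₁, Y₂⟩ hp
  simp only [mem_product, mem_subpolymers] at hp
  obtain ⟨⟨h1, hp1⟩, ⟨h2, hp2⟩⟩ := hp
  have e : (X₁ ∪ X₂) \ (Y₁ ∪ Y₂) = (X₁ \ Y₁) ∪ (X₂ \ Y₂) := by
    ext x
    simp only [mem_sdiff, mem_union, not_or]
    constructor
    · rintro ⟨hx | hx, hn₁, hn₂⟩
      · exact Or.inl ⟨hx, hn₁⟩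
      · exact Or.inr ⟨hx, hn₂⟩
    · rintro (⟨hx, hn⟩ | ⟨hx, hn⟩)
      · exact ⟨Or.inl hx, hn, fun h => disjoint_left.1 hd hx (h2 h)⟩
      · exact ⟨Or.inr hx, fun h => disjoint_left.1 hd (h1 h) hx, hn⟩
  simp only
  rw [e, hF Y₁ Y₂ hp1 hp2 h1 h2, hG (X₁ \ Y₁) (X₂ \ Y₂) (hX₁.sdiff hp1) (hX₂.sdiff hp2) sdiff_subset sdiff_subset]
  ring

/-- For non-touching polymers, `Comp(A ∪ B) = Comp(A) ∪ Comp(B)` (disjointly). [folklore] -/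
theorem components_union_of_not_touch {A B : Finset (TorusSite d M)} (hA : IsPolymer b A) (hB : IsPolymer b B)
    (h : ¬ Touch A B) : components (A ∪ B) = components A ∪ components B ∧ Disjoint (components A) (components B) := by
  classical
  have hGA := isGas_components hA
  have hGB := isGas_components hB
  have hdisj : Disjoint (components A) (components B) := by
    rw [Finset.disjoint_left]
    intro Y hYA hYB
    obtain ⟨y, hy⟩ := nonempty_of_mem_components hYA
    exact h ⟨y, subset_of_mem_components hYA hy, y, subset_of_mem_components hYB hy, Or.inl rfl⟩
  have hG : IsGas b (components A ∪ components B) := by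
    refine ⟨fun Y hY => ?_, fun Y₁ h₁ Y₂ h₂ hne => ?_⟩
    · rcases mem_union.1 hY with hY | hY
      · exact hGA.1 Y hY
      · exact hGB.1 Y hY
    · rcases mem_union.1 h₁ with h₁ | h₁ <;> rcases mem_union.1 h₂ with h₂ | h₂
      · exact hGA.2 Y₁ h₁ Y₂ h₂ hne
      · exact fun ht => h (ht.mono (subset_of_mem_components h₁) (subset_of_mem_components h₂))
      · exact fun ht => h ((ht.mono (subset_of_mem_components h₁) (subset_of_mem_components h₂)).symm)
      · exact hGB.2 Y₁ h₁ Y₂ h₂ hne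
  refine ⟨?_, hdisj⟩
  have hu : (components A ∪ components B).biUnion id = A ∪ B := by
    rw [Finset.union_biUnion, biUnion_components_id, biUnion_components_id]
  rw [← hu, hG.components_biUnion]

/-- **A component-factorising activity is multiplicative over non-touching polymers**:
`K(A ∪ B) = K(A) K(B)`. [folklore] -/
theorem mul_of_factorises {K : Finset (TorusSite d M) → R} (hK : ∀ X, IsPolymer b X → K X = ∏ Y ∈ components X, K Y)
    {A B : Finset (TorusSite d M)} (hA : IsPolymer b A) (hB : IsPolymer b B) (h : ¬ Touch A B) :
    K (A ∪ B) = K A * K B := by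
  classical
  obtain ⟨hu, hd⟩ := components_union_of_not_touch hA hB h
  rw [hK _ (hA.union hB), hu, Finset.prod_union hd, ← hK A hA, ← hK B hB]

end UnionSplit

section MapThreeFactorisation

variable {A N : Type*} [CommRing A] [CommRing N] {b b' : ℕ} (ι θ : A →+* N) (E : N → A)
  (Sup : Finset (TorusSite d M) → N → Prop)

/-- The closure of a `b`-polymer inside a non-touching union `U₁ ∪ U₂` of `b'`-polymers splits:
`X ∩ U₁` has closure `U₁`. [folklore] -/
theorem inter_mem_closureFiber {U₁ U₂ X : Finset (TorusSite d M)} (hU₁ : IsPolymer b' U₁) (hU₂ : IsPolymer b' U₂)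
    (hd : Disjoint U₁ U₂) (hbb : b ∣ b') (hX : X ∈ closureFiber b b' (U₁ ∪ U₂)) :
    X ∩ U₁ ∈ closureFiber b b' U₁ := by
  classical
  obtain ⟨hXp, hXc⟩ := mem_closureFiber.1 hX
  refine mem_closureFiber.2 ⟨hXp.inter (hU₁.of_dvd hbb), Subset.antisymm (bclosure_subset hU₁ inter_subset_right) ?_⟩
  intro u hu
  have hu' : u ∈ bclosure b' X := hXc.symm ▸ mem_union_left _ hu
  obtain ⟨x, hx, hux⟩ := mem_biUnion.1 hu'
  have hxU : x ∈ U₁ ∪ U₂ := (hXc ▸ subset_bclosure b' X) hx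
  rcases mem_union.1 hxU with hx1 | hx2
  · exact mem_biUnion.2 ⟨x, mem_inter.2 ⟨hx, hx1⟩, hux⟩
  · exact absurd (hU₂ hx2 hux) (disjoint_left.1 hd hu)

/-- The closure of a union is the union of the closures. [folklore] -/
theorem bclosure_union (X₁ X₂ : Finset (TorusSite d M)) : bclosure b' (X₁ ∪ X₂) = bclosure b' X₁ ∪ bclosure b' X₂ := by
  classical
  unfold bclosure
  exact Finset.union_biUnion

/-- Splitting `𝒫̄_j(U₁ ∪ U₂) ≅ 𝒫̄_j(U₁) × 𝒫̄_j(U₂)` for disjoint `b'`-polymers: re-indexing a sum. [folklore] -/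
theorem sum_closureFiber_union {β : Type*} [AddCommMonoid β] {U₁ U₂ : Finset (TorusSite d M)}
    (hU₁ : IsPolymer b' U₁) (hU₂ : IsPolymer b' U₂) (hd : Disjoint U₁ U₂) (hbb : b ∣ b') (f : Finset (TorusSite d M) → β) :
    ∑ X ∈ closureFiber b b' (U₁ ∪ U₂), f X = ∑ p ∈ closureFiber b b' U₁ ×ˢ closureFiber b b' U₂, f (p.1 ∪ p.2) := by
  classical
  have key : ∀ X ∈ closureFiber b b' (U₁ ∪ U₂), X ∩ U₁ ∪ X ∩ U₂ = X := fun X hX => by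
    rw [← inter_union_distrib_left, inter_eq_left.2 ((mem_closureFiber.1 hX).2 ▸ subset_bclosure b' X)]
  refine Finset.sum_nbij' (fun X => (X ∩ U₁, X ∩ U₂)) (fun p => p.1 ∪ p.2) ?_ ?_ ?_ ?_ ?_
  · intro X hX
    rw [mem_product]
    refine ⟨inter_mem_closureFiber hU₁ hU₂ hd hbb hX, inter_mem_closureFiber hU₂ hU₁ hd.symm hbb ?_⟩
    rwa [union_comm]
  · rintro ⟨X₁, X₂⟩ hp
    rw [mem_product, mem_closureFiber, mem_closureFiber] at hp
    obtain ⟨⟨hp1, hc1⟩, ⟨hp2, hc2⟩⟩ := hp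
    refine mem_closureFiber.2 ⟨hp1.union hp2, ?_⟩
    rw [bclosure_union, hc1, hc2]
  · intro X hX
    exact key X hX
  · rintro ⟨X₁, X₂⟩ hp
    rw [mem_product, mem_closureFiber, mem_closureFiber] at hp
    have h1 : X₁ ⊆ U₁ := hp.1.2 ▸ subset_bclosure b' X₁
    have h2 : X₂ ⊆ U₂ := hp.2.2 ▸ subset_bclosure b' X₂
    simp only [Prod.mk.injEq]
    constructor
    · rw [union_inter_distrib_right, inter_eq_left.2 h1, disjoint_iff_inter_eq_empty.1 (hd.symm.mono_left h2), union_empty]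
    · rw [union_inter_distrib_right, inter_eq_left.2 h2, disjoint_iff_inter_eq_empty.1 (hd.mono_left h1), empty_union]
  · intro X hX
    show f X = f (X ∩ U₁ ∪ X ∩ U₂)
    rw [key X hX]

/-- `subpolymers b ∅ = {∅}`. [folklore] -/
theorem subpolymers_empty : subpolymers b (∅ : Finset (TorusSite d M)) = {∅} := by
  ext X
  rw [mem_subpolymers, mem_singleton]
  constructor
  · rintro ⟨h, -⟩; exact subset_empty.1 h
  · rintro rfl; exact ⟨subset_refl _, isPolymer_empty b⟩

/-- `𝒫̄_j(∅) = {∅}`. [folklore] -/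
theorem closureFiber_empty : closureFiber b b' (∅ : Finset (TorusSite d M)) = {∅} := by
  ext X
  rw [mem_closureFiber, mem_singleton]
  constructor
  · rintro ⟨-, h⟩
    exact subset_empty.1 (h ▸ subset_bclosure b' X)
  · rintro rfl
    refine ⟨isPolymer_empty b, ?_⟩
    simp [bclosure]

/-- **`K^{(3)}(∅) = 1`** (given `K(∅) = 1` and `E 1 = 1`). [cite: BrydgesSlade2015RGV, §1.4 ("All functions F : 𝒫_j → 𝒩 that we consider are required to obey F(∅) = 1")] -/
theorem kthree_empty (Ihat Itil K : Finset (TorusSite d M) → A) (hK0 : K ∅ = 1) (hE1 : E 1 = 1) :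
    kthree b b' ι θ E Ihat Itil K ∅ = 1 := by
  unfold kthree circ
  rw [closureFiber_empty, Finset.sum_singleton, subpolymers_empty, Finset.sum_singleton]
  simp [hK0, hE1]

/-- Hypotheses on an abstract "depends on the fluctuation field only in `D`" predicate `Sup D n`
on the big algebra (for the RG: `n(φ, ζ)` is a measurable function of `ζ|_D` for each `φ`),
used to transport the factorisation property of `𝔼₊`. [cite: BrydgesSlade2015RGV, §1.3 (display (Efaczz)) and §5.1 (proof of Proposition (prop:K3))] -/
structure SupHyp (b : ℕ) (ι θ : A →+* N) (Sup : Finset (TorusSite d M) → N → Prop)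
    (Ihat Itil K : Finset (TorusSite d M) → A) : Prop where
  /-- monotone in the region -/
  mono : ∀ D D' n, Sup D n → D ⊆ D' → Sup D' n
  /-- closed under products -/
  mul : ∀ D n m, Sup D n → Sup D m → Sup D (n * m)
  /-- closed under differences -/
  sub : ∀ D n m, Sup D n → Sup D m → Sup D (n - m)
  /-- closed under finite products -/
  prod : ∀ D (s : Finset (Finset (TorusSite d M))) (f : Finset (TorusSite d M) → N),
    (∀ i ∈ s, Sup D (f i)) → Sup D (∏ i ∈ s, f i)
  /-- closed under finite sums -/
  sum : ∀ D (s : Finset (Finset (TorusSite d M))) (f : Finset (TorusSite d M) → N),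
    (∀ i ∈ s, Sup D (f i)) → Sup D (∑ i ∈ s, f i)
  /-- the fluctuation-free factors `Ĩ_pt(B)` -/
  iota : ∀ D x, Sup D (ι (Itil (block b x)))
  /-- `θÎ(B) ∈ 𝒩̃(B^□)` -/
  thetaI : ∀ x, Sup (sclosure b (block b x)) (θ (Ihat (block b x)))
  /-- `θK(Y) ∈ 𝒩̃(Y^□)` -/
  thetaK : ∀ Y, IsPolymer b Y → Sup (sclosure b Y) (θ (K Y))

variable {ι θ Sup}

/-- `δI^Y ∈ 𝒩̃(Z^□)` for a polymer `Y ⊆ Z`. [folklore] -/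
theorem SupHyp.blockProd_deltaI {Ihat Itil K : Finset (TorusSite d M) → A} (h : SupHyp b ι θ Sup Ihat Itil K)
    {Y Z : Finset (TorusSite d M)} (hY : IsPolymer b Y) (hYZ : Y ⊆ Z) :
    Sup (sclosure b Z) (blockProd b (deltaI ι θ Ihat Itil) Y) := by
  refine h.prod _ _ _ fun B hB => ?_
  obtain ⟨x, hx, rfl⟩ := exists_eq_block_of_mem_blocksOf hB
  refine h.sub _ _ _ (h.mono _ _ _ (h.thetaI x) (sclosure_mono b ((hY hx).trans hYZ))) (h.iota _ x)

/-- `(δI ∘ θK)(X) ∈ 𝒩̃(X^□)` ("field locality is straightforward"). [cite: BrydgesSlade2015RGV, §5.1 (proof of Proposition (prop:K3): "To see that K^{(3)} is in 𝒦_{j+1}, the field locality is straightforward")] -/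
theorem SupHyp.circ_deltaI {Ihat Itil K : Finset (TorusSite d M) → A} (h : SupHyp b ι θ Sup Ihat Itil K)
    {X : Finset (TorusSite d M)} (hX : IsPolymer b X) :
    Sup (sclosure b X) (circ b (blockProd b (deltaI ι θ Ihat Itil)) (fun Y => θ (K Y)) X) := by
  unfold circ
  refine h.sum _ _ _ fun Y hY => ?_
  obtain ⟨hYX, hYp⟩ := mem_subpolymers.1 hY
  exact h.mul _ _ _ (h.blockProd_deltaI hYp hYX) (h.mono _ _ _ (h.thetaK _ (hX.sdiff hYp)) (sclosure_mono b sdiff_subset))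

variable (ι θ Sup)

/-- The separation condition under which `𝔼₊` factorises: the two regions lie in the small-set
neighbourhoods of two non-touching `(j+1)`-polymers. [cite: BrydgesSlade2015RGV, §1.3 (display (Efaczz): "if X_1,…,X_n ∈ 𝒫_{j+1}(Λ) do not touch each other, and if F_m(X_m) ∈ 𝒩(X_m)")] -/
def SepCond (b b' : ℕ) (D₁ D₂ : Finset (TorusSite d M)) : Prop :=
  ∃ U₁ U₂ : Finset (TorusSite d M), IsPolymer b' U₁ ∧ IsPolymer b' U₂ ∧ ¬ Touch U₁ U₂ ∧
    D₁ ⊆ sclosure b U₁ ∧ D₂ ⊆ sclosure b U₂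

/-- **`K^{(3)}` is multiplicative over non-touching `(j+1)`-polymers** ("Component factorisation
is an immediate consequence of the factorisation properties for `K^{(2)}` and the finite-range
property (Efaczz) of `𝔼₊`"): `K^{(3)}(U₁ ∪ U₂) = K^{(3)}(U₁) K^{(3)}(U₂)`, assuming `𝔼₊` factorises
on separated products (`hEfac`) and `K^{(2)}` is multiplicative over non-touching polymers.
[cite: BrydgesSlade2015RGV, §5.1, Proposition (prop:K3) (proof, "To see that K^{(3)} is in 𝒦_{j+1} …")] -/
theorem kthree_union (hbb : b ∣ b') {Ihat Itil K : Finset (TorusSite d M) → A} (hS : SupHyp b ι θ Sup Ihat Itil K)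
    (hEfac : ∀ D₁ D₂ n₁ n₂, Sup D₁ n₁ → Sup D₂ n₂ → SepCond b b' D₁ D₂ → E (n₁ * n₂) = E n₁ * E n₂)
    (hK : ∀ Y₁ Y₂, IsPolymer b Y₁ → IsPolymer b Y₂ → ¬ Touch Y₁ Y₂ → K (Y₁ ∪ Y₂) = K Y₁ * K Y₂)
    {U₁ U₂ : Finset (TorusSite d M)} (hU₁ : IsPolymer b' U₁) (hU₂ : IsPolymer b' U₂) (h12 : ¬ Touch U₁ U₂) :
    kthree b b' ι θ E Ihat Itil K (U₁ ∪ U₂) = kthree b b' ι θ E Ihat Itil K U₁ * kthree b b' ι θ E Ihat Itil K U₂ := by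
  classical
  have hd : Disjoint U₁ U₂ := disjoint_of_not_touch h12
  unfold kthree
  rw [sum_closureFiber_union hU₁ hU₂ hd hbb, Finset.sum_mul_sum, ← Finset.sum_product']
  refine Finset.sum_congr rfl ?_
  rintro ⟨X₁, X₂⟩ hp
  rw [mem_product, mem_closureFiber, mem_closureFiber] at hp
  obtain ⟨⟨hp1, hc1⟩, ⟨hp2, hc2⟩⟩ := hp
  have h1 : X₁ ⊆ U₁ := hc1 ▸ subset_bclosure b' X₁
  have h2 : X₂ ⊆ U₂ := hc2 ▸ subset_bclosure b' X₂
  have hU₁b : IsPolymer b U₁ := hU₁.of_dvd hbb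
  have hU₂b : IsPolymer b U₂ := hU₂.of_dvd hbb
  -- the background
  have e : (U₁ ∪ U₂) \ (X₁ ∪ X₂) = (U₁ \ X₁) ∪ (U₂ \ X₂) := by
    ext x
    simp only [mem_sdiff, mem_union, not_or]
    constructor
    · rintro ⟨hx | hx, hn₁, hn₂⟩
      · exact Or.inl ⟨hx, hn₁⟩
      · exact Or.inr ⟨hx, hn₂⟩
    · rintro (⟨hx, hn⟩ | ⟨hx, hn⟩)
      · exact ⟨Or.inl hx, hn, fun h => disjoint_left.1 hd hx (h2 h)⟩
      · exact ⟨Or.inr hx, fun h => disjoint_left.1 hd (h1 h) hx, hn⟩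
  simp only
  rw [e, blockProd_union Itil (hU₁b.sdiff hp1) (hU₂b.sdiff hp2)
    ((hd.mono_left sdiff_subset).mono_right sdiff_subset)]
  -- the circle product splits
  rw [circ_union_eq_mul hp1 hp2 ((hd.mono_left h1).mono_right h2) (fun A B hA hB _ _ => ?_) (fun A B hA hB hA1 hB2 => ?_)]
  · -- the expectation factorises
    rw [hEfac _ _ _ _ (hS.circ_deltaI hp1) (hS.circ_deltaI hp2)
      ⟨U₁, U₂, hU₁, hU₂, h12, sclosure_mono b h1, sclosure_mono b h2⟩]
    ring
  · -- `δI^{A ∪ B} = δI^A δI^B`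
    refine blockProd_union _ hA hB ?_
    exact (((hd.mono_left h1).mono_right h2).mono_left ‹A ⊆ X₁›).mono_right ‹B ⊆ X₂›
  · -- `θK(A ∪ B) = θK(A) θK(B)` for non-touching `A, B`
    rw [hK A B hA hB fun ht => h12 (ht.mono (hA1.trans h1) (hB2.trans h2)), map_mul]

/-- **`K^{(3)}` over a gas of `(j+1)`-polymers.** [cite: BrydgesSlade2015RGV, §5.1, Proposition (prop:K3)] -/
theorem kthree_biUnion_of_isGas (hbb : b ∣ b') {Ihat Itil K : Finset (TorusSite d M) → A} (hS : SupHyp b ι θ Sup Ihat Itil K)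
    (hEfac : ∀ D₁ D₂ n₁ n₂, Sup D₁ n₁ → Sup D₂ n₂ → SepCond b b' D₁ D₂ → E (n₁ * n₂) = E n₁ * E n₂)
    (hK : ∀ Y₁ Y₂, IsPolymer b Y₁ → IsPolymer b Y₂ → ¬ Touch Y₁ Y₂ → K (Y₁ ∪ Y₂) = K Y₁ * K Y₂)
    (hK0 : K ∅ = 1) (hE1 : E 1 = 1) {G : Finset (Finset (TorusSite d M))} (hG : IsGas b' G) :
    kthree b b' ι θ E Ihat Itil K (G.biUnion id) = ∏ Z ∈ G, kthree b b' ι θ E Ihat Itil K Z := by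
  classical
  induction G using Finset.induction_on with
  | empty => simp [kthree_empty (b := b) (b' := b') ι θ E Ihat Itil K hK0 hE1]
  | @insert Z G hZ ih =>
    have hG' : IsGas b' G := hG.subset (subset_insert _ _)
    rw [Finset.biUnion_insert, Finset.prod_insert hZ, id, ← ih hG']
    exact kthree_union ι θ E Sup hbb hS hEfac hK (hG.1 Z (mem_insert_self _ _)).1 hG'.isPolymer_biUnion
      (hG.not_touch_biUnion hZ)

/-- **Component factorisation of `K^{(3)}` at scale `j+1`** (`K^{(3)} ∈ 𝒦_{j+1}`, algebraic part):
`K^{(3)}(U) = ∏_{Z ∈ Comp_{j+1}(U)} K^{(3)}(Z)`. [cite: BrydgesSlade2015RGV, §5.1, Proposition (prop:K3) ("K^{(3)} ∈ 𝒦_{j+1}")] [cite: Slade2017, Definition 6.1.2 (component factorisation)] -/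
theorem kthree_eq_prod_components (hbb : b ∣ b') {Ihat Itil K : Finset (TorusSite d M) → A} (hS : SupHyp b ι θ Sup Ihat Itil K)
    (hEfac : ∀ D₁ D₂ n₁ n₂, Sup D₁ n₁ → Sup D₂ n₂ → SepCond b b' D₁ D₂ → E (n₁ * n₂) = E n₁ * E n₂)
    (hK : ∀ Y₁ Y₂, IsPolymer b Y₁ → IsPolymer b Y₂ → ¬ Touch Y₁ Y₂ → K (Y₁ ∪ Y₂) = K Y₁ * K Y₂)
    (hK0 : K ∅ = 1) (hE1 : E 1 = 1) {U : Finset (TorusSite d M)} (hU : IsPolymer b' U) :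
    kthree b b' ι θ E Ihat Itil K U = ∏ Z ∈ components U, kthree b b' ι θ E Ihat Itil K Z := by
  classical
  rw [← kthree_biUnion_of_isGas ι θ E Sup hbb hS hEfac hK hK0 hE1 (isGas_components hU), biUnion_components_id]

end MapThreeFactorisation

end Polymer

end LongRangePhi4

end Literature.Barriers.CriticalPhenomena
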